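import Summits.QuantumFields.BalabanUV.T4Continuum.Support.ShellMeasureLinearizedChart
import Literature.MathematicalPhysics.QuantumFieldTheory.Balaban1983to89.T4AveragingDisintegration
import Mathlib.Probability.Kernel.Disintegration.Unique

/-!
# `T4Continuum.ShellMeasureLinearizedCondLaw` — (LR)_j: THE CURVED-CHART FIBRE LAWS ARE THE CELL'S `condLaw`
# (a.e. uniqueness of the disintegration along a LINEARIZABLE average)
# (cell `pub-balaban`, sub-cell `t4`, spine estimate NE7c (node U5b); NE7c ROUND-2 crew `t4-ne7c-formalise-*`, seat
# `b2b-balaban-t4-ne7c-formalise-leaf-03` (gen 2); an idle-seat OFFER (journal `CLAIMS.log` l.12152) inside the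
# orbit of leaf-09-g7's «(LR)_j — the curved fibre chart for a linearizable average» (files `ShellMeasureLinearized
# {Chart, Constraint, Disintegration, Toy}`, p216580 / p216585 / p216736 / p216738), taking the ONE step file 4 names
# and leaves out («no `condKernel` uniqueness is invoked»); ADDITIVE — imports file 1 `ShellMeasureLinearizedChart`,
# the cell's disintegration vocabulary `T4AveragingDisintegration` (Literature, [folklore] §1) and Mathlib's
# `Probability.Kernel.Disintegration.Unique` only, modifies nothing; 0 `def`, 0 sorry, 0 cite)

HONEST FRAMING.  Finite four-torus programme, rung (B)+1 only — NOT infinite volume, NOT a mass gap, NOT the Clay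
problem, NOT summit progress; (B), `BetaPertHyp`, (B^μ) are not consumed.  (M1) for Bałaban's inductively defined
effective measures is NOT PRINTED (GAPS G-ne7cp1-1), asserted by nobody, NOT moved here.  NE7c ⇐ the named binders
(trigger c3); NE7c NOT PRINTED, NOT proved; spine PROVED 0/9 before and after.  STRUCTURAL BOOKKEEPING — [folklore]
measure theory (Tonelli, file 1's change of variables, Mathlib's a.e. uniqueness of the conditional kernel
`ProbabilityTheory.eq_condKernel_of_measure_eq_compProd`); no estimate, no `def` (c2), no citation; Bałaban's block
average is NOT shown linearizable here (print's statement, [Balaban1987RG1] p. 267, TYPED in `B12Lineariz267`, not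
instantiated).  HONEST DEPENDENCY (cell, verbatim): continuum YM on T⁴ ⇐ BetaPertH ∧ nine spine estimates (0/9
proved); BetaPertH ⇐ (D1) ∧ (D4) ∧ CAP+tail; G-an2-4 gates asym, D1 and NE2/3/4.

THE POINT.  The cell types a renormalization step measure-theoretically through `T4AveragingDisintegration`: the joint
law `jointLaw ν avg = ν.map (U ↦ (avg U, U))` of (coarse, fine) and THE conditional kernel
`condLaw ν avg := (jointLaw ν avg).condKernel` («the law of `U` given `Ū = V`», the kernel form of print's
`δ(ŪV⁻¹)`; consumed by the RT-kernel typing `avgKernel` / `rtOpIOfKernel` / `disintegration_fieldMeasure`).  File 1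
(`ShellMeasureLinearizedChart.map_linearizedChart_eq_smul`) identifies the block law `ν = (μE⌞Φ(O)).withDensity G`
with `c⁻¹ ×` the image of the tilted product law `μK ⊗ μF` under the full chart `(x, b) ↦ Φ (σ b + Ψ (x, 0))`, and
file 4 reads this, under the linearization hypothesis `hlin`, as an identity of iterated integrals — the fibre law at
`b` being «`x ↦ Φ (σ b + Ψ (x, 0))` pushes `Gt (σ b + Ψ (x, 0)) dμK(x)`», EXPLICIT «up to normalisation by its mass»,
with «no `condKernel` uniqueness invoked».  THIS FILE invokes it:
* §1 `exists_const_lintegral_graph` — file 4's disintegration identity with the constant `c` chosen ONCE, uniformly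
  in the integrand (`∃ c, … ∧ ∀ g, c · ∫ g (Q y, y) dν = ∫ db ∫ g (b, Φ(σ b + Ψ(x,0))) Gt(σ b + Ψ(x,0)) dμK`), and
  the LAW OF THE NONLINEAR AVERAGE: `c • ν.map Q = μF.withDensity m`, `m b = ∫ Gt (σ b + Ψ (x, 0)) dμK(x)` the fibre
  mass (print's normalisation factors).
* §2 `condLaw_ae_eq_fibreLaw` — THE JUNCTION: for `ν` FINITE and `(ν.map Q)`-almost every average value `b`, the
  fibre mass is `0 < m b < ∞` and the cell's conditional kernel IS the normalised curved-chart fibre law,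
  `condLaw ν Q b = (m b)⁻¹ • ((μK.withDensity (Gt (σ b + Ψ (·, 0)))).map (Φ (σ b + Ψ (·, 0))))`.
  Proof: the normalised fibre laws form a finite kernel `κ` (measurability from Tonelli), `jointLaw ν Q =
  (ν.map Q) ⊗ₘ κ` by §1, and Mathlib's `eq_condKernel_of_measure_eq_compProd` (the block space is standard Borel).
  SANITY `example`: the LINEAR case (identity chart, `Q y = (Ψ.symm y).2` — FC f4's model): the section-chart fibre
  laws of leaf-10's FC f3/f4 are the cell's `condLaw` too.  `fibreLaw_apply_ne_average_eq_zero`: the explicit fibre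
  law gives NO mass to `{Q ≠ b}` for EVERY `b` (the cell's `condLaw_fibre_ae` has it for almost every `b`).
So on the (LR)_j road the CONSTRAINED reading's fibre law (leaf-10's FC f3 / leaf-09-g7's file 2, T-NE7c-8) is not a
presentation-dependent choice: it is, fibre by fibre and up to null sets of average values, THE conditional law of the
block variable given its nonlinear average — the object every other disintegration of `ν` along `Q` must reproduce
(file 1 §2's remark «a definition-independent object», now a theorem), stated in the vocabulary the cell's other rows
use for the averaging constraint.
WHAT THIS DOES NOT DO.  No instance of SM-L1/L3/L4/L6 at any `j ≥ 1`; no slot density is identified with print's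
integrand; the linearizability of Bałaban's block average at a live slot stays print's statement (B12 p. 267 / B13
Sect. C TYPE); (M1) per slot stays THE wall; NOTHING in the countdown moves; NE7c NOT proved; 0/9.
-/

noncomputable section

open Set Function MeasureTheory MeasureTheory.Measure Metric ProbabilityTheory

namespace Summit.QuantumFields.BalabanUV.T4Continuum.ShellMeasureLinearizedCondLaw

open scoped ENNReal NNReal
open Literature.MathematicalPhysics.QuantumFieldTheory.Balaban1983to89
open T4AveragingDisintegration (jointLaw condLaw jointLaw_fst measurable_graphMap)
open ShellMeasureLinearizedChart (map_linearizedChart_eq_smul average_linearizedChart)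

variable {E F Kf : Type*} [NormedAddCommGroup E] [NormedSpace ℝ E] [MeasurableSpace E] [BorelSpace E]
  [FiniteDimensional ℝ E] (μE : Measure E) [μE.IsAddHaarMeasure]
  [NormedAddCommGroup F] [NormedSpace ℝ F] [MeasurableSpace F] [BorelSpace F] [FiniteDimensional ℝ F]
  [NormedAddCommGroup Kf] [NormedSpace ℝ Kf] [MeasurableSpace Kf] [BorelSpace Kf] [FiniteDimensional ℝ Kf]
  (μK : Measure Kf) [μK.IsAddHaarMeasure] (μF : Measure F) [μF.IsAddHaarMeasure]

/-! ## §1 The disintegration identity with ONE constant; the law of the nonlinear average -/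

/-- **DISINTEGRATION ALONG A LINEARIZABLE AVERAGE, UNIFORM CONSTANT.**  Data as in file 1's
`map_linearizedChart_eq_smul` (splitting `Ψ`, measurable section `σ`, measurable window `O`, measurable chart `Φ`
injective on `O` with derivative `Φ'` within `O`, density `G`, measurable pulled-back density
`Gt = 1_O·|det Φ'|·G∘Φ`) plus a measurable average `Q` LINEARIZED by `Φ` on `O` (`hlin`).  Then there is ONE constant
`0 < c < ∞` (file 1's, the Lebesgue normalisation of the splitting) such that (i) for EVERY measurable
`g : F × E → ℝ≥0∞`: `c · ∫ g (Q y, y) d((μE⌞Φ(O)).withDensity G)(y) = ∫_F ∫_Kf g (b, Φ (σ b + Ψ (x, 0))) ·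
Gt (σ b + Ψ (x, 0)) dμK(x) dμF(b)` (file 4's `lintegral_average_linearizedChart`, whose constant is quantified per
integrand — re-derived here from file 1 so that `c` is uniform), and (ii) THE LAW OF THE NONLINEAR AVERAGE under the
block law has Lebesgue density `c⁻¹ · m`, `m b = ∫ Gt (σ b + Ψ (x, 0)) dμK(x)` the fibre mass:
`c • (ν.map Q) = μF.withDensity m`. [folklore] -/
theorem exists_const_lintegral_graph (Ψ : (Kf × F) ≃L[ℝ] E) {σ : F → E} (hσm : Measurable σ)
    (hσ : ∀ b, (Ψ.symm (σ b)).2 = b) {O : Set E} (hO : MeasurableSet O) {Φ : E → E} (hΦm : Measurable Φ)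
    (hinj : InjOn Φ O) {Φ' : E → E →L[ℝ] E} (hΦ' : ∀ y ∈ O, HasFDerivWithinAt Φ (Φ' y) O y)
    (G : E → ℝ≥0∞) {Gt : E → ℝ≥0∞} (hGtm : Measurable Gt)
    (hGt : ∀ y, Gt y = O.indicator (fun y => ENNReal.ofReal |(Φ' y).det| * G (Φ y)) y)
    {Q : E → F} (hQ : Measurable Q) (hlin : ∀ y ∈ O, Q (Φ y) = (Ψ.symm y).2) :
    ∃ c : ℝ≥0∞, c ≠ 0 ∧ c ≠ ∞ ∧
      (∀ {g : F × E → ℝ≥0∞}, Measurable g →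
        c * ∫⁻ y, g (Q y, y) ∂((μE.restrict (Φ '' O)).withDensity G) =
          ∫⁻ b, ∫⁻ x, g (b, Φ (σ b + Ψ (x, 0))) * Gt (σ b + Ψ (x, 0)) ∂μK ∂μF) ∧
      c • ((μE.restrict (Φ '' O)).withDensity G).map Q =
        μF.withDensity fun b => ∫⁻ x, Gt (σ b + Ψ (x, 0)) ∂μK := by
  obtain ⟨c, hc0, hc1, hmap⟩ :=
    map_linearizedChart_eq_smul μE μK μF Ψ hσm hσ hO hΦm hinj hΦ' G hGtm hGt
  have hch : Measurable fun p : Kf × F => σ p.2 + Ψ (p.1, 0) :=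
    (hσm.comp measurable_snd).add (Ψ.continuous.measurable.comp (measurable_fst.prodMk measurable_const))
  have hT : Measurable fun p : Kf × F => Φ (σ p.2 + Ψ (p.1, 0)) := hΦm.comp hch
  have hf' : Measurable fun p : Kf × F => Gt (σ p.2 + Ψ (p.1, 0)) := hGtm.comp hch
  -- (i) the identity for every integrand, with THIS `c` (file 4's computation)
  have key : ∀ {g : F × E → ℝ≥0∞}, Measurable g →
      c * ∫⁻ y, g (Q y, y) ∂((μE.restrict (Φ '' O)).withDensity G) =
        ∫⁻ b, ∫⁻ x, g (b, Φ (σ b + Ψ (x, 0))) * Gt (σ b + Ψ (x, 0)) ∂μK ∂μF := by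
    intro g hg
    have hgQ : Measurable fun y : E => g (Q y, y) := hg.comp (hQ.prodMk measurable_id)
    have hg' : Measurable fun p : Kf × F => g (Q (Φ (σ p.2 + Ψ (p.1, 0))), Φ (σ p.2 + Ψ (p.1, 0))) :=
      hgQ.comp hT
    rw [← smul_eq_mul, ← lintegral_smul_measure, ← hmap, lintegral_map hgQ hT,
      lintegral_withDensity_eq_lintegral_mul _ hf' hg']
    have hpt : ∀ p : Kf × F, Gt (σ p.2 + Ψ (p.1, 0)) * g (Q (Φ (σ p.2 + Ψ (p.1, 0))), Φ (σ p.2 + Ψ (p.1, 0))) =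
        g (p.2, Φ (σ p.2 + Ψ (p.1, 0))) * Gt (σ p.2 + Ψ (p.1, 0)) := fun p => by
      by_cases hp : σ p.2 + Ψ (p.1, 0) ∈ O
      · rw [average_linearizedChart Ψ hσ hlin p.1 p.2 hp, mul_comm]
      · rw [hGt, indicator_of_notMem hp, zero_mul, mul_zero]
    simp only [Pi.mul_apply, hpt]
    exact lintegral_prod_symm _ ((hg.comp (measurable_snd.prodMk hT)).mul (hGtm.comp hch)).aemeasurable
  refine ⟨c, hc0, hc1, key, ?_⟩
  -- (ii) the marginal law of the average: test against indicators
  ext s hs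
  rw [Measure.smul_apply, smul_eq_mul, Measure.map_apply hQ hs, withDensity_apply _ hs,
    ← lintegral_indicator hs, ← lintegral_indicator_one (hQ hs)]
  have h1 : (fun y : E => (Q ⁻¹' s).indicator (1 : E → ℝ≥0∞) y) =
      fun y => s.indicator (fun _ => (1 : ℝ≥0∞)) (Q y) := by
    funext y
    by_cases hy : Q y ∈ s
    · rw [indicator_of_mem (show y ∈ Q ⁻¹' s from hy), indicator_of_mem hy, Pi.one_apply]
    · rw [indicator_of_notMem (show y ∉ Q ⁻¹' s from hy), indicator_of_notMem hy]
  have hk := key (g := fun q : F × E => s.indicator (fun _ => (1 : ℝ≥0∞)) q.1)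
    ((measurable_const.indicator hs).comp measurable_fst)
  dsimp only at hk
  rw [h1, hk]
  refine lintegral_congr fun b => ?_
  by_cases hb : b ∈ s
  · simp only [indicator_of_mem hb, one_mul]
  · simp only [indicator_of_notMem hb, zero_mul, lintegral_zero]

/-! ## §2 THE JUNCTION: `condLaw` IS the normalised curved-chart fibre law, a.e. -/

/-- **THE CELL'S CONDITIONAL KERNEL ALONG A LINEARIZABLE AVERAGE IS THE NORMALISED CURVED-CHART FIBRE LAW (a.e.).**
Data as in §1, the block law `ν := (μE⌞Φ(O)).withDensity G` being FINITE (so that `T4AveragingDisintegration.condLaw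
ν Q` — «the law of the block variable given its average», `(jointLaw ν Q).condKernel` — is defined; the block space is
standard Borel as a finite-dimensional real normed space).  Then for `(ν.map Q)`-ALMOST EVERY average value `b`:
the fibre mass `m b = ∫ Gt (σ b + Ψ (x, 0)) dμK(x)` is `0 < m b < ∞`, and
`condLaw ν Q b = (m b)⁻¹ • ((μK.withDensity fun x => Gt (σ b + Ψ (x, 0))).map fun x => Φ (σ b + Ψ (x, 0)))` — the
curved fibre chart `x ↦ Φ (σ b + Ψ (x, 0))` (file 1 §3: it charts `{Q = b} ∩ Φ(O)`) pushes the normalised tilted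
Lebesgue law of the linear fibre model onto THE conditional law.  Proof: the normalised fibre laws form a finite
kernel `κ` (Tonelli measurability), `jointLaw ν Q = (ν.map Q) ⊗ₘ κ` by §1 (the exceptional average values — fibre
mass `0` or `∞` — are `(ν.map Q)`-null by §1 (ii)), and Mathlib's a.e. uniqueness of the conditional kernel
`ProbabilityTheory.eq_condKernel_of_measure_eq_compProd`.  CONDITIONAL on every binder; nothing of Bałaban's is
asserted; the linearizability `hlin` is print's displayed-TYPE statement (B12 p. 267). [folklore] -/
theorem condLaw_ae_eq_fibreLaw (Ψ : (Kf × F) ≃L[ℝ] E) {σ : F → E} (hσm : Measurable σ)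
    (hσ : ∀ b, (Ψ.symm (σ b)).2 = b) {O : Set E} (hO : MeasurableSet O) {Φ : E → E} (hΦm : Measurable Φ)
    (hinj : InjOn Φ O) {Φ' : E → E →L[ℝ] E} (hΦ' : ∀ y ∈ O, HasFDerivWithinAt Φ (Φ' y) O y)
    (G : E → ℝ≥0∞) {Gt : E → ℝ≥0∞} (hGtm : Measurable Gt)
    (hGt : ∀ y, Gt y = O.indicator (fun y => ENNReal.ofReal |(Φ' y).det| * G (Φ y)) y)
    {Q : E → F} (hQ : Measurable Q) (hlin : ∀ y ∈ O, Q (Φ y) = (Ψ.symm y).2)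
    [IsFiniteMeasure ((μE.restrict (Φ '' O)).withDensity G)] :
    ∀ᵐ b ∂(((μE.restrict (Φ '' O)).withDensity G).map Q),
      0 < ∫⁻ x, Gt (σ b + Ψ (x, 0)) ∂μK ∧ ∫⁻ x, Gt (σ b + Ψ (x, 0)) ∂μK < ∞ ∧
      (condLaw ((μE.restrict (Φ '' O)).withDensity G) Q b : Measure E) =
        (∫⁻ x, Gt (σ b + Ψ (x, 0)) ∂μK)⁻¹ •
          (μK.withDensity fun x => Gt (σ b + Ψ (x, 0))).map fun x => Φ (σ b + Ψ (x, 0)) := by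
  set ν : Measure E := (μE.restrict (Φ '' O)).withDensity G
  -- measurability of the chart pieces, average value first
  have hch2 : Measurable fun p : F × Kf => σ p.1 + Ψ (p.2, 0) :=
    (hσm.comp measurable_fst).add (Ψ.continuous.measurable.comp (measurable_snd.prodMk measurable_const))
  have hT2 : Measurable fun p : F × Kf => Φ (σ p.1 + Ψ (p.2, 0)) := hΦm.comp hch2
  have hg2 : Measurable fun p : F × Kf => Gt (σ p.1 + Ψ (p.2, 0)) := hGtm.comp hch2
  have hTb : ∀ b : F, Measurable fun x : Kf => Φ (σ b + Ψ (x, 0)) := fun b =>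
    hT2.comp (measurable_const.prodMk measurable_id)
  -- the (unnormalised) fibre laws and their masses
  set fib : F → Measure E := fun b =>
    (μK.withDensity fun x => Gt (σ b + Ψ (x, 0))).map fun x => Φ (σ b + Ψ (x, 0)) with hfib
  set m : F → ℝ≥0∞ := fun b => ∫⁻ x, Gt (σ b + Ψ (x, 0)) ∂μK with hm
  have hfibs : ∀ {s : Set E}, MeasurableSet s → ∀ b, fib b s =
      ∫⁻ x, s.indicator (fun _ => (1 : ℝ≥0∞)) (Φ (σ b + Ψ (x, 0))) * Gt (σ b + Ψ (x, 0)) ∂μK := by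
    intro s hs b
    simp only [hfib]
    rw [Measure.map_apply (hTb b) hs, withDensity_apply _ ((hTb b) hs), ← lintegral_indicator ((hTb b) hs)]
    refine lintegral_congr fun x => ?_
    by_cases hx : Φ (σ b + Ψ (x, 0)) ∈ s
    · rw [indicator_of_mem (show x ∈ (fun x : Kf => Φ (σ b + Ψ (x, 0))) ⁻¹' s from hx), indicator_of_mem hx,
        one_mul]
    · rw [indicator_of_notMem (show x ∉ (fun x : Kf => Φ (σ b + Ψ (x, 0))) ⁻¹' s from hx),
        indicator_of_notMem hx, zero_mul]
  have hmeas_fib : ∀ {s : Set E}, MeasurableSet s → Measurable fun b => fib b s := by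
    intro s hs
    have h : Measurable fun p : F × Kf =>
        s.indicator (fun _ => (1 : ℝ≥0∞)) (Φ (σ p.1 + Ψ (p.2, 0))) * Gt (σ p.1 + Ψ (p.2, 0)) :=
      ((measurable_const.indicator hs).comp hT2).mul hg2
    simp_rw [hfibs hs]
    exact h.lintegral_prod_right'
  have hm_meas : Measurable m := hg2.lintegral_prod_right'
  have hm_univ : ∀ b, fib b univ = m b := fun b => by
    rw [hfibs MeasurableSet.univ]
    simp only [indicator_univ, one_mul, hm]
  -- the comparison kernel: normalised fibre laws
  have hκmeas : Measurable fun b => (m b)⁻¹ • fib b :=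
    Measure.measurable_of_measurable_coe _ fun s hs => by
      simp only [Measure.smul_apply, smul_eq_mul]
      exact hm_meas.inv.mul (hmeas_fib hs)
  let κ : Kernel F E := ⟨fun b => (m b)⁻¹ • fib b, hκmeas⟩
  have hκ_apply : ∀ b, κ b = (m b)⁻¹ • fib b := fun _ => rfl
  haveI : IsFiniteKernel κ := ⟨⟨1, ENNReal.one_lt_top, fun b => by
    rw [hκ_apply, Measure.smul_apply, smul_eq_mul, hm_univ]
    exact ENNReal.inv_mul_le_one _⟩⟩
  -- §1 with ONE constant: the graph identity and the marginal law
  obtain ⟨c, hc0, hc1, key, hmarg⟩ :=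
    exists_const_lintegral_graph μE μK (addHaar : Measure F) Ψ hσm hσ hO hΦm hinj hΦ' G hGtm hGt hQ hlin
  have hmargl : ∀ {φ : F → ℝ≥0∞}, Measurable φ → c * ∫⁻ b, φ b ∂(ν.map Q) = ∫⁻ b, φ b * m b ∂(addHaar : Measure F) := by
    intro φ hφ
    rw [← smul_eq_mul, ← lintegral_smul_measure, hmarg, lintegral_withDensity_eq_lintegral_mul _ hm_meas hφ]
    exact lintegral_congr fun b => mul_comm _ _
  -- the fibre mass is finite for Lebesgue-a.e. average value (`ν` is finite)
  have hm_top : ∀ᵐ b ∂(addHaar : Measure F), m b < ∞ := by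
    refine ae_lt_top hm_meas ?_
    have h := hmargl measurable_const (φ := fun _ => (1 : ℝ≥0∞))
    simp only [lintegral_const, one_mul, Measure.map_apply hQ MeasurableSet.univ, preimage_univ] at h
    rw [← h]
    exact ENNReal.mul_ne_top hc1 (measure_ne_top ν _)
  -- THE DISINTEGRATION: `jointLaw ν Q = (ν.map Q) ⊗ₘ κ`
  have hdis : jointLaw ν Q = (jointLaw ν Q).fst ⊗ₘ κ := by
    rw [jointLaw_fst ν hQ]
    ext s hs
    rw [Measure.compProd_apply hs]
    refine (ENNReal.mul_right_inj hc0 hc1).1 ?_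
    -- left: `c · jointLaw s = ∫ fib b (b-slice of s) dμF`
    have hL : c * jointLaw ν Q s = ∫⁻ b, fib b (Prod.mk b ⁻¹' s) ∂(addHaar : Measure F) := by
      rw [jointLaw, Measure.map_apply (measurable_graphMap hQ) hs,
        ← lintegral_indicator_one ((measurable_graphMap hQ) hs)]
      have h1 : (fun y : E => ((fun U : E => (Q U, U)) ⁻¹' s).indicator (1 : E → ℝ≥0∞) y) =
          fun y => (s.indicator fun _ => (1 : ℝ≥0∞)) (Q y, y) := by
        funext y
        by_cases hy : (Q y, y) ∈ s
        · rw [indicator_of_mem (show y ∈ (fun U : E => (Q U, U)) ⁻¹' s from hy), indicator_of_mem hy,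
            Pi.one_apply]
        · rw [indicator_of_notMem (show y ∉ (fun U : E => (Q U, U)) ⁻¹' s from hy), indicator_of_notMem hy]
      rw [h1, key (g := s.indicator fun _ => (1 : ℝ≥0∞)) (measurable_const.indicator hs)]
      refine lintegral_congr fun b => ?_
      rw [hfibs (measurable_prodMk_left hs)]
      refine lintegral_congr fun x => ?_
      by_cases hx : (b, Φ (σ b + Ψ (x, 0))) ∈ s
      · rw [indicator_of_mem hx, indicator_of_mem (show Φ (σ b + Ψ (x, 0)) ∈ Prod.mk b ⁻¹' s from hx)]
      · rw [indicator_of_notMem hx,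
          indicator_of_notMem (show Φ (σ b + Ψ (x, 0)) ∉ Prod.mk b ⁻¹' s from hx)]
    -- right: `c · ∫ κ b (slice) d(ν.map Q) = ∫ κ b (slice) · m b dμF = ∫ fib b (slice) dμF`
    have hR : c * ∫⁻ b, κ b (Prod.mk b ⁻¹' s) ∂(ν.map Q) = ∫⁻ b, fib b (Prod.mk b ⁻¹' s) ∂(addHaar : Measure F) := by
      rw [hmargl (Kernel.measurable_kernel_prodMk_left hs)]
      refine lintegral_congr_ae ?_
      filter_upwards [hm_top] with b hb
      rw [hκ_apply, Measure.smul_apply, smul_eq_mul]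
      by_cases h0 : m b = 0
      · have hle : fib b (Prod.mk b ⁻¹' s) ≤ m b := (measure_mono (subset_univ _)).trans (hm_univ b).le
        have hz : fib b (Prod.mk b ⁻¹' s) = 0 := le_antisymm (hle.trans h0.le) zero_le
        rw [hz, mul_zero, zero_mul]
      · rw [mul_comm (m b)⁻¹, mul_assoc, ENNReal.inv_mul_cancel h0 hb.ne, mul_one]
    rw [hL, hR]
  -- Mathlib's a.e. uniqueness of the conditional kernel
  have hu := eq_condKernel_of_measure_eq_compProd κ hdis
  rw [jointLaw_fst ν hQ] at hu
  -- the exceptional average values (fibre mass `0` or `∞`) are `(ν.map Q)`-null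
  have hac : ν.map Q ≪ (addHaar : Measure F) := fun s hs0 => by
    have h : c * ν.map Q s = 0 := by
      rw [← smul_eq_mul, ← Measure.smul_apply, hmarg]
      exact withDensity_absolutelyContinuous _ _ hs0
    exact (mul_eq_zero.1 h).resolve_left hc0
  have h0 : ν.map Q {b | m b = 0} = 0 := by
    have hs : MeasurableSet {b | m b = 0} := hm_meas (measurableSet_singleton 0)
    have h : c * ν.map Q {b | m b = 0} = 0 := by
      rw [← smul_eq_mul, ← Measure.smul_apply, hmarg, withDensity_apply _ hs, ← lintegral_indicator hs]
      refine (lintegral_eq_zero_iff (hm_meas.indicator hs)).2 (ae_of_all _ fun b => ?_)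
      by_cases hb : b ∈ {b | m b = 0}
      · rw [indicator_of_mem hb]; exact hb
      · rw [indicator_of_notMem hb]; rfl
    exact (mul_eq_zero.1 h).resolve_left hc0
  filter_upwards [hu, hac.ae_le hm_top, measure_eq_zero_iff_ae_notMem.1 h0] with b hb htop hne
  refine ⟨pos_iff_ne_zero.2 hne, htop, ?_⟩
  rw [show condLaw ν Q = (jointLaw ν Q).condKernel from rfl, ← hb]
  exact hκ_apply b

/-- **SANITY — THE LINEAR CASE (FC f4's model).**  Identity chart (`Φ = id`, `O = univ`, `|det Φ'| = 1`) and the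
LINEAR average `Q y = (Ψ.symm y).2` (the splitting's second coordinate, linearized by the identity): §2 specialises
to «the conditional law of the block variable given its linear average is the normalised SECTION-CHART fibre law
`x ↦ σ b + Ψ (x, 0)` pushing `G (σ b + Ψ (x, 0)) dμK(x)`» — leaf-10's FC f3/f4 fibre laws are the cell's `condLaw`
too.  Statement written out, obtained from `condLaw_ae_eq_fibreLaw` with `Gt = G`. [folklore] -/
example (Ψ : (Kf × F) ≃L[ℝ] E) {σ : F → E} (hσm : Measurable σ) (hσ : ∀ b, (Ψ.symm (σ b)).2 = b)
    {G : E → ℝ≥0∞} (hG : Measurable G)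
    [IsFiniteMeasure ((μE.restrict ((fun y : E => y) '' univ)).withDensity G)] :
    ∀ᵐ b ∂(((μE.restrict ((fun y : E => y) '' univ)).withDensity G).map fun y => (Ψ.symm y).2),
      0 < ∫⁻ x, G (σ b + Ψ (x, 0)) ∂μK ∧ ∫⁻ x, G (σ b + Ψ (x, 0)) ∂μK < ∞ ∧
      (condLaw ((μE.restrict ((fun y : E => y) '' univ)).withDensity G) (fun y => (Ψ.symm y).2) b :
          Measure E) =
        (∫⁻ x, G (σ b + Ψ (x, 0)) ∂μK)⁻¹ •
          (μK.withDensity fun x => G (σ b + Ψ (x, 0))).map fun x => σ b + Ψ (x, 0) := by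
  have hGt : ∀ y : E, G y = (univ : Set E).indicator
      (fun y => ENNReal.ofReal |(ContinuousLinearMap.id ℝ E).det| * G ((fun y : E => y) y)) y := fun y => by
    simp [ContinuousLinearMap.det]
  exact condLaw_ae_eq_fibreLaw μE μK Ψ hσm hσ MeasurableSet.univ (Φ := fun y : E => y) measurable_id
    (injOn_id _) (Φ' := fun _ => ContinuousLinearMap.id ℝ E) (fun y _ => hasFDerivWithinAt_id y univ) G hG hGt
    (measurable_snd.comp Ψ.symm.continuous.measurable) (fun _ _ => rfl)

omit [FiniteDimensional ℝ Kf] [μK.IsAddHaarMeasure] in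
/-- **THE FIBRE LAW LIVES ON THE FIBRE — FOR EVERY AVERAGE VALUE.**  Under the linearization hypothesis `hlin` the
explicit curved-chart fibre law at `b`, `(μK.withDensity (Gt (σ b + Ψ (·, 0)))).map (Φ (σ b + Ψ (·, 0)))`, gives NO
mass to `{Q ≠ b}`: on the window the charted point has average `b` (file 1 `average_linearizedChart`), off the window
the pulled-back density `Gt = 1_O·|det Φ'|·G∘Φ` vanishes.  (The cell's `condLaw_fibre_ae` says this for the
conditional kernel at ALMOST every `b`; the explicit version holds at every `b`.) [folklore] -/
theorem fibreLaw_apply_ne_average_eq_zero (Ψ : (Kf × F) ≃L[ℝ] E) {σ : F → E}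
    (hσ : ∀ b, (Ψ.symm (σ b)).2 = b) {O : Set E} {Φ : E → E} (hΦm : Measurable Φ)
    {Φ' : E → E →L[ℝ] E} (G : E → ℝ≥0∞) {Gt : E → ℝ≥0∞} (hGtm : Measurable Gt)
    (hGt : ∀ y, Gt y = O.indicator (fun y => ENNReal.ofReal |(Φ' y).det| * G (Φ y)) y)
    {Q : E → F} (hQ : Measurable Q) (hlin : ∀ y ∈ O, Q (Φ y) = (Ψ.symm y).2) (b : F) :
    ((μK.withDensity fun x => Gt (σ b + Ψ (x, 0))).map fun x => Φ (σ b + Ψ (x, 0))) {y | Q y ≠ b} = 0 := by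
  have hchb : Measurable fun x : Kf => σ b + Ψ (x, 0) :=
    measurable_const.add (Ψ.continuous.measurable.comp (measurable_id.prodMk measurable_const))
  have hTb : Measurable fun x : Kf => Φ (σ b + Ψ (x, 0)) := hΦm.comp hchb
  have hs : MeasurableSet {y : E | Q y ≠ b} := (hQ (measurableSet_singleton b)).compl
  have hgb : Measurable fun x : Kf => Gt (σ b + Ψ (x, 0)) := hGtm.comp hchb
  rw [Measure.map_apply hTb hs, withDensity_apply _ (hTb hs), setLIntegral_eq_zero_iff (hTb hs) hgb]
  refine ae_of_all _ fun x hx => ?_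
  by_cases hO : σ b + Ψ (x, 0) ∈ O
  · exact absurd (average_linearizedChart Ψ hσ hlin x b hO) hx
  · rw [hGt, indicator_of_notMem hO]

end Summit.QuantumFields.BalabanUV.T4Continuum.ShellMeasureLinearizedCondLaw

end
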